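import Mathlib
import Summits.Ventures.PercRepro2.Defs
import Summits.Ventures.PercRepro2.Harris
import Summits.Ventures.PercRepro2.Graph
import Summits.Ventures.PercRepro2.Exploration
import Summits.Ventures.PercRepro2.Events
import Summits.Ventures.PercRepro2.CutVertexDefs
import Summits.Ventures.PercRepro2.CDCutVertex

/-!
# The three-event form (T_h) across a cut vertex, the mirror placement (blind cell PercRepro2,
mine-a g46; MINE-A.md §101.5)

The companion of `TCutVertex` (not imported: the proof is self-contained): the cut vertex `x` (`CutV.IsCut ends x VA VB EA EB`) now separates the
root `s ∈ VA` and the up-sets — READ ON THE ROOT SIDE `VA ∪ {x}` (`S ∈ 𝓤 ↔ S ∩ (VA ∪ {x}) ∈ 𝓤`) — from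
the hit vertex `h ∈ VB`.  Then `{C_s ∈ 𝓤}` is an `A`-side event (`clusterInEvent_eq_side`,
`CutV.cluster_inter_eq`), `{h ∈ C_s} = {s ↔ x inside A} ∩ {h ∈ C_x inside B}`, and the product law
gives the EXACT identity

  **`T(p, s, h) = P_{p_B}(h ∈ C_x) · T(p_A, s, x)`**   (`t_cut_identity_near`)

with `p_A` (`p_B`) the weight vector closing the `B`-edges (`A`-edges): the hit vertex may be moved
to the cut vertex, at the price of the far-side connection probability.  Hence (T_h) on `G` follows
from the (T)-inequality on the `A`-side with the hit vertex `x` (`t_of_cut_near`).  With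
`TCutVertex.t_of_cut` (up-sets beyond the cut) the two extreme supports are covered; for up-sets with
generators on both sides the far-side form is a MIXTURE over the near-side cluster and is not reduced
here.  No definition; one seat.
-/

namespace Summit.Ventures.PercRepro2

namespace TCutVertexNear

open CutV

variable {V : Type*} {E : Type*}

/-! ## The mirror: the hit vertex beyond the cut, the up-sets read on the root side -/
section NearSide

variable [Fintype E] [DecidableEq E] {R : Type*} [Field R] [LinearOrder R] [IsStrictOrderedRing R]
variable {ends : E → Sym2 V} {x : V} {VA VB : Set V} {EA EB : Set E}
  [DecidablePred (· ∈ EA)] [DecidablePred (· ∈ EB)]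

omit [Fintype E] [DecidableEq E] [Field R] [LinearOrder R] [IsStrictOrderedRing R]
  [DecidablePred (· ∈ EB)] in
/-- **A cluster event read on the root side is an `A`-side event**: for an up-set `𝓤` with
`S ∈ 𝓤 ↔ S ∩ (VA ∪ {x}) ∈ 𝓤`, `{C_s ∈ 𝓤} = {C_s inside A ∈ 𝓤}`. -/
theorem clusterInEvent_eq_side (h : IsCut ends x VA VB EA EB) {s : V} (hs : s ∈ VA)
    {𝓤 : Set (Set V)} (h𝓤 : ∀ S, S ∈ 𝓤 ↔ S ∩ (VA ∪ {x}) ∈ 𝓤) :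
    clusterInEvent ends s 𝓤 = sideEvent EA (clusterInEvent ends s 𝓤) := by
  ext ω
  simp only [mem_clusterInEvent, mem_sideEvent]
  rw [h𝓤 (cluster ends ω s), cluster_inter_eq h (Or.inl hs)]

omit [Fintype E] [DecidableEq E] [Field R] [LinearOrder R] [IsStrictOrderedRing R]
  [DecidablePred (· ∈ EA)] [DecidablePred (· ∈ EB)] in
/-- The hit event of the cut vertex is the connection event `{s ↔ x}`. -/
lemma hit_cut_eq_connEvent (s : V) :
    clusterInEvent ends s {T : Set V | x ∈ T} = connEvent ends s x := by
  ext ω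
  simp only [mem_clusterInEvent, Set.mem_setOf_eq, mem_cluster]
  exact Iff.rfl

omit [LinearOrder R] [IsStrictOrderedRing R] in
/-- The probability of `{A-side event} ∩ {B-side event}` as `P_{p_A}(·) · P_{p_B}(·)`, the two weight
vectors closing the other side. -/
lemma prob_side_inter_side (p : E → R) (h : IsCut ends x VA VB EA EB) (X Y : Set (Config E)) :
    prob p (sideEvent EA X ∩ sideEvent EB Y) =
      prob (fun e => if e ∈ EA then p e else 0) X * prob (fun e => if e ∈ EB then p e else 0) Y := by
  rw [prob_sideEvent_inter_eq_mul p h, CDCutVertex.prob_zeroOff_eq_prob_sideEvent p EA X,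
    CDCutVertex.prob_zeroOff_eq_prob_sideEvent p EB Y]

omit [LinearOrder R] [IsStrictOrderedRing R] in
/-- **The (T)-form with the hit vertex beyond the cut and the up-sets read on the root side**:
`T(p, s, h) = P_{p_B}(h ∈ C_x) · T(p_A, s, x)`, where `p_A` (`p_B`) closes the `B`-edges (`A`-edges). -/
theorem t_cut_identity_near (p : E → R) (h : IsCut ends x VA VB EA EB) {s hv : V} (hs : s ∈ VA)
    (hvB : hv ∈ VB) {𝓤 𝓥 : Set (Set V)} (h𝓤 : ∀ S, S ∈ 𝓤 ↔ S ∩ (VA ∪ {x}) ∈ 𝓤)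
    (h𝓥 : ∀ S, S ∈ 𝓥 ↔ S ∩ (VA ∪ {x}) ∈ 𝓥) :
    prob p (clusterInEvent ends s {T : Set V | hv ∈ T} ∩ clusterInEvent ends s 𝓤 ∩
        clusterInEvent ends s 𝓥) +
      prob p (clusterInEvent ends s {T : Set V | hv ∈ T}) *
        prob p (clusterInEvent ends s 𝓤 ∩ clusterInEvent ends s 𝓥) -
      prob p (clusterInEvent ends s {T : Set V | hv ∈ T} ∩ clusterInEvent ends s 𝓤) *
        prob p (clusterInEvent ends s 𝓥) -
      prob p (clusterInEvent ends s {T : Set V | hv ∈ T} ∩ clusterInEvent ends s 𝓥) *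
        prob p (clusterInEvent ends s 𝓤) =
    prob (fun e => if e ∈ EB then p e else 0) (clusterInEvent ends x {T : Set V | hv ∈ T}) *
      (prob (fun e => if e ∈ EA then p e else 0)
          (clusterInEvent ends s {T : Set V | x ∈ T} ∩ clusterInEvent ends s 𝓤 ∩
            clusterInEvent ends s 𝓥) +
        prob (fun e => if e ∈ EA then p e else 0) (clusterInEvent ends s {T : Set V | x ∈ T}) *
          prob (fun e => if e ∈ EA then p e else 0)
            (clusterInEvent ends s 𝓤 ∩ clusterInEvent ends s 𝓥) -
        prob (fun e => if e ∈ EA then p e else 0)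
            (clusterInEvent ends s {T : Set V | x ∈ T} ∩ clusterInEvent ends s 𝓤) *
          prob (fun e => if e ∈ EA then p e else 0) (clusterInEvent ends s 𝓥) -
        prob (fun e => if e ∈ EA then p e else 0)
            (clusterInEvent ends s {T : Set V | x ∈ T} ∩ clusterInEvent ends s 𝓥) *
          prob (fun e => if e ∈ EA then p e else 0) (clusterInEvent ends s 𝓤)) := by
  have hQm : ∀ ω : Config E, hv ∈ cluster ends ω s ↔
      (x ∈ cluster ends (restrict EA ω) s ∧ hv ∈ cluster ends (restrict EB ω) x) := fun ω => by
    rw [mem_cluster_of_mem_B_iff h hs hvB, mem_cluster_x_iff h hs]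
    exact Iff.rfl
  have hUm : ∀ ω : Config E, cluster ends ω s ∈ 𝓤 ↔ cluster ends (restrict EA ω) s ∈ 𝓤 := fun ω => by
    rw [h𝓤 (cluster ends ω s), cluster_inter_eq h (Or.inl hs)]
  have hEm : ∀ ω : Config E, cluster ends ω s ∈ 𝓥 ↔ cluster ends (restrict EA ω) s ∈ 𝓥 := fun ω => by
    rw [h𝓥 (cluster ends ω s), cluster_inter_eq h (Or.inl hs)]
  -- the seven events
  have s1 : clusterInEvent ends s {T : Set V | hv ∈ T} ∩ clusterInEvent ends s 𝓤 ∩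
      clusterInEvent ends s 𝓥 =
      sideEvent EA (clusterInEvent ends s {T : Set V | x ∈ T} ∩ clusterInEvent ends s 𝓤 ∩
        clusterInEvent ends s 𝓥) ∩ sideEvent EB (clusterInEvent ends x {T : Set V | hv ∈ T}) := by
    ext ω
    change (hv ∈ cluster ends ω s ∧ cluster ends ω s ∈ 𝓤) ∧ cluster ends ω s ∈ 𝓥 ↔
      ((x ∈ cluster ends (restrict EA ω) s ∧ cluster ends (restrict EA ω) s ∈ 𝓤) ∧
        cluster ends (restrict EA ω) s ∈ 𝓥) ∧ hv ∈ cluster ends (restrict EB ω) x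
    rw [hQm ω, hUm ω, hEm ω]
    tauto
  have s2 : clusterInEvent ends s {T : Set V | hv ∈ T} =
      sideEvent EA (clusterInEvent ends s {T : Set V | x ∈ T}) ∩
        sideEvent EB (clusterInEvent ends x {T : Set V | hv ∈ T}) := by
    ext ω
    change hv ∈ cluster ends ω s ↔
      x ∈ cluster ends (restrict EA ω) s ∧ hv ∈ cluster ends (restrict EB ω) x
    exact hQm ω
  have s3 : clusterInEvent ends s 𝓤 ∩ clusterInEvent ends s 𝓥 =
      sideEvent EA (clusterInEvent ends s 𝓤 ∩ clusterInEvent ends s 𝓥) := by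
    ext ω
    change cluster ends ω s ∈ 𝓤 ∧ cluster ends ω s ∈ 𝓥 ↔
      cluster ends (restrict EA ω) s ∈ 𝓤 ∧ cluster ends (restrict EA ω) s ∈ 𝓥
    rw [hUm ω, hEm ω]
  have s4 : clusterInEvent ends s {T : Set V | hv ∈ T} ∩ clusterInEvent ends s 𝓤 =
      sideEvent EA (clusterInEvent ends s {T : Set V | x ∈ T} ∩ clusterInEvent ends s 𝓤) ∩
        sideEvent EB (clusterInEvent ends x {T : Set V | hv ∈ T}) := by
    ext ω
    change hv ∈ cluster ends ω s ∧ cluster ends ω s ∈ 𝓤 ↔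
      (x ∈ cluster ends (restrict EA ω) s ∧ cluster ends (restrict EA ω) s ∈ 𝓤) ∧
        hv ∈ cluster ends (restrict EB ω) x
    rw [hQm ω, hUm ω]
    tauto
  have s5 : clusterInEvent ends s 𝓥 = sideEvent EA (clusterInEvent ends s 𝓥) := by
    ext ω
    change cluster ends ω s ∈ 𝓥 ↔ cluster ends (restrict EA ω) s ∈ 𝓥
    exact hEm ω
  have s6 : clusterInEvent ends s {T : Set V | hv ∈ T} ∩ clusterInEvent ends s 𝓥 =
      sideEvent EA (clusterInEvent ends s {T : Set V | x ∈ T} ∩ clusterInEvent ends s 𝓥) ∩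
        sideEvent EB (clusterInEvent ends x {T : Set V | hv ∈ T}) := by
    ext ω
    change hv ∈ cluster ends ω s ∧ cluster ends ω s ∈ 𝓥 ↔
      (x ∈ cluster ends (restrict EA ω) s ∧ cluster ends (restrict EA ω) s ∈ 𝓥) ∧
        hv ∈ cluster ends (restrict EB ω) x
    rw [hQm ω, hEm ω]
    tauto
  have s7 : clusterInEvent ends s 𝓤 = sideEvent EA (clusterInEvent ends s 𝓤) := by
    ext ω
    change cluster ends ω s ∈ 𝓤 ↔ cluster ends (restrict EA ω) s ∈ 𝓤
    exact hUm ω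
  -- the seven probabilities
  have p1 := congrArg (prob p) s1
  have p2 := congrArg (prob p) s2
  have p3 := congrArg (prob p) s3
  have p4 := congrArg (prob p) s4
  have p5 := congrArg (prob p) s5
  have p6 := congrArg (prob p) s6
  have p7 := congrArg (prob p) s7
  rw [prob_side_inter_side p h] at p1 p2 p4 p6
  rw [← CDCutVertex.prob_zeroOff_eq_prob_sideEvent p EA] at p3 p5 p7
  rw [p1, p4, p6, p2, p3, p5, p7]
  ring

/-- **(T_h) transfers across a cut vertex toward the hit vertex**: with `h` beyond the cut vertex
`x` and the up-sets read on the root side, (T_h) on `G` follows from the (T)-inequality on the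
`A`-side with the hit vertex `x`. -/
theorem t_of_cut_near (p : E → R) (hp : IsProbVec p) (h : IsCut ends x VA VB EA EB) {s hv : V}
    (hs : s ∈ VA) (hvB : hv ∈ VB) {𝓤 𝓥 : Set (Set V)}
    (h𝓤 : ∀ S, S ∈ 𝓤 ↔ S ∩ (VA ∪ {x}) ∈ 𝓤) (h𝓥 : ∀ S, S ∈ 𝓥 ↔ S ∩ (VA ∪ {x}) ∈ 𝓥)
    (hA : prob (fun e => if e ∈ EA then p e else 0)
            (clusterInEvent ends s {T : Set V | x ∈ T} ∩ clusterInEvent ends s 𝓤) *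
          prob (fun e => if e ∈ EA then p e else 0) (clusterInEvent ends s 𝓥) +
        prob (fun e => if e ∈ EA then p e else 0) (clusterInEvent ends s 𝓤) *
          prob (fun e => if e ∈ EA then p e else 0)
            (clusterInEvent ends s {T : Set V | x ∈ T} ∩ clusterInEvent ends s 𝓥) ≤
        prob (fun e => if e ∈ EA then p e else 0)
            (clusterInEvent ends s {T : Set V | x ∈ T} ∩ clusterInEvent ends s 𝓤 ∩
              clusterInEvent ends s 𝓥) +
          prob (fun e => if e ∈ EA then p e else 0) (clusterInEvent ends s {T : Set V | x ∈ T}) *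
            prob (fun e => if e ∈ EA then p e else 0)
              (clusterInEvent ends s 𝓤 ∩ clusterInEvent ends s 𝓥)) :
    prob p (clusterInEvent ends s {T : Set V | hv ∈ T} ∩ clusterInEvent ends s 𝓤) *
        prob p (clusterInEvent ends s 𝓥) +
      prob p (clusterInEvent ends s 𝓤) *
        prob p (clusterInEvent ends s {T : Set V | hv ∈ T} ∩ clusterInEvent ends s 𝓥) ≤
      prob p (clusterInEvent ends s {T : Set V | hv ∈ T} ∩ clusterInEvent ends s 𝓤 ∩
          clusterInEvent ends s 𝓥) +
        prob p (clusterInEvent ends s {T : Set V | hv ∈ T}) *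
          prob p (clusterInEvent ends s 𝓤 ∩ clusterInEvent ends s 𝓥) := by
  have hid := t_cut_identity_near p h hs hvB h𝓤 h𝓥
  have hpB : IsProbVec (fun e => if e ∈ EB then p e else 0) := CDCutVertex.isProbVec_zeroOff hp EB
  have hq : 0 ≤ prob (fun e => if e ∈ EB then p e else 0)
      (clusterInEvent ends x {T : Set V | hv ∈ T}) := prob_nonneg hpB _
  have hT : 0 ≤ prob (fun e => if e ∈ EA then p e else 0)
          (clusterInEvent ends s {T : Set V | x ∈ T} ∩ clusterInEvent ends s 𝓤 ∩
            clusterInEvent ends s 𝓥) +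
        prob (fun e => if e ∈ EA then p e else 0) (clusterInEvent ends s {T : Set V | x ∈ T}) *
          prob (fun e => if e ∈ EA then p e else 0)
            (clusterInEvent ends s 𝓤 ∩ clusterInEvent ends s 𝓥) -
        prob (fun e => if e ∈ EA then p e else 0)
            (clusterInEvent ends s {T : Set V | x ∈ T} ∩ clusterInEvent ends s 𝓤) *
          prob (fun e => if e ∈ EA then p e else 0) (clusterInEvent ends s 𝓥) -
        prob (fun e => if e ∈ EA then p e else 0)
            (clusterInEvent ends s {T : Set V | x ∈ T} ∩ clusterInEvent ends s 𝓥) *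
          prob (fun e => if e ∈ EA then p e else 0) (clusterInEvent ends s 𝓤) := by
    linarith
  have h1 := mul_nonneg hq hT
  linarith [hid, h1]

end NearSide

end TCutVertexNear

end Summit.Ventures.PercRepro2
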